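import Mathlib
import Summits.KontsevichZagierPeriods.Zeta5Search.CatalanTwoAdicZeta
import HarnessLib

/-!
# Catalan box family — kernel K5e: `ξ` is the 2-adic interpolation of the Dirichlet-beta values `β(1−n)`

HONEST FRAMING: systematic search; no irrationality claim unless certified.

Cell `pub-zeta5`, seat `fam-catalan` (generation 5), project "kernel K5e" (`families/catalan/FAMILY.md` §11).
K5d (`CatalanTwoAdicZeta.xi_eq_zetaTwoAtTwo`) identified the lane's 2-adic constant `ξ = ⅛Σ'_μ t_μ/(μ+½)` with the number
`zetaTwoAtTwo` DEFINED by Washington's explicit Bernoulli series for the Kubota–Leopoldt value `ζ₂(2)` ([Wa97, Thm. 5.11]).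
This file removes the dependence on that particular formula: it proves that `ξ` has THE DEFINING PROPERTY of `ζ₂(2)` —
it is the 2-adic limit of the (rational) values at negative integers that the Kubota–Leopoldt function interpolates.

* For `p = 2` the Kubota–Leopoldt zeta function satisfies `ζ₂(1−n) = −(1 − ω^{−n}(2)2^{n−1})·B_{n,ω^{−n}}/n` ([Wa97, Thm. 5.11]);
  for ODD `n` this is `−B_{n,χ₋₄}/n = L(1−n, χ₋₄) = β(1−n)` (`χ₋₄ = ω` the odd character mod `4`, Euler factor `1`), i.e. the
  value at `1−n` of the archimedean Dirichlet beta function `β(s) = Σ_{m≥0} (−1)^m (2m+1)^{−s}` ([Wa97, Thm. 4.2]: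
  `L(1−n,χ) = −B_{n,χ}/n`; [Wa97, Prop. 4.1]: `B_{n,χ} = f^{n−1} Σ_{a=1}^{f} χ(a) B_n(a/f)`), and `β(2) = G` is Catalan's
  constant.  We put, for `n ≥ 1`,
  `betaOneSub n := −4^{n−1}·(B_n(¼) − B_n(¾))/n ∈ ℚ` (`B_n(x)` = Mathlib's `Polynomial.bernoulli n`), `= β(1−n)` for odd `n`
  (`= E_{n−1}/2`, `E` the Euler numbers: `½, −½, 5/2, −61/2, …` at `n = 1, 3, 5, 7`).
* **`LFunction_chiFour_one_sub`** (0 sorry): for `n ≥ 2`, `betaOneSub n` IS the value at `s = 1 − n` of Mathlib's analytically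
  continued Dirichlet `L`-function `ZMod.LFunction χ₋₄` (kernel form of [Wa97, Prop. 4.1 + Thm. 4.2], from Mathlib's
  `hurwitzZeta_neg_nat`); so below "β(1−n)" is a genuine `L`-value, not a formula.
* **`tendsto_betaOneSub_xi : Tendsto (fun N ↦ (betaOneSub (2^N − 1) : ℚ₂)) atTop (𝓝 ξ)`** (0 sorry): as `s = 1 − n` runs
  through `2 − 2^N → 2` in `ℤ₂` (`n = 2^N − 1`, odd), the rational numbers `β(1−n)` converge 2-adically to `ξ`.  Since
  `ζ₂` is by definition the continuous 2-adic interpolation of these values, this says `ξ = ζ₂(2)` with no formula for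
  `ζ₂` presupposed (what stays printed is only the EXISTENCE/continuity of the Kubota–Leopoldt function, i.e. that the
  name `ζ₂(2)` denotes this limit); `eq_xi_of_tendsto` records that the limit determines `ξ`, and
  `xi_is_twoAdic_limit_of_LValues` packages it: ONE sequence of rationals is `L(2 − 2^N, χ₋₄)` in `ℂ` and `→ ξ` in `ℚ₂`.
  So: the central-binomial series `Σ 4^n/((2n+1)²binom(2n,n))` sums to `2β(2) = 2G` in `ℝ` and to
  `2·lim_{N} β(2 − 2^N) = 2ζ₂(2)` in `ℚ₂`.
* PROOF = the interpolation mechanism of [Wa97, Thm. 5.11] made explicit at one point: by `B_n(x) = Σ_i binom(n,i)B_i x^{n−i}`,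
  `betaOneSub n = −(4n)⁻¹·(Σ_{i≤n} binom(n,i)B_i4^i − 3^n·Σ_{i≤n} binom(n,i)B_i(4/3)^i)` (Washington's series at `s = 1−n`,
  where it terminates: `⟨3⟩^{n} = (−3)^n`).  Along `n = 2^N − 1`: `n → −1`, `3^n = 3^{2^N}/3 → 1/3`
  (`‖3^{2^N} − 1‖₂ ≤ 2^{−N−1}`), `binom(n, j) → binom(−1, j) = (−1)^j` for each `j`, and the two sums converge to
  `Σ'_j (−1)^jB_j4^j`, `Σ'_j (−1)^jB_j(4/3)^j` by Tannery's theorem (Mathlib `tendsto_tsum_of_dominated_convergence`) with the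
  dominating sequence `C·2^{−j}` (`‖binom‖₂ ≤ 1`, `‖B_j‖₂ ≤ C2^j` from K5d/K5b, `‖4^j‖₂ = ‖(4/3)^j‖₂ = 4^{−j}`); the limit is
  `¼(Σ'(−1)^jB_j4^j − ⅓Σ'(−1)^jB_j(4/3)^j) = H₂(2;1,4) + H₂(2;3,4) = zetaTwoAtTwo = ξ` (K5d).
  Numerically (exact arithmetic, `families/catalan/lean/kl_interp_check.py`): `v₂(E_{2^N−2}/2 − ξ) = N − 1` for `N = 2,…,12`.
-/

open Finset Nat Filter Topology

noncomputable section

namespace Summit.KontsevichZagierPeriods.Zeta5Search.CatalanTwoAdicInterpolation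

open CatalanTwoAdicSeries (xi norm_two_padic)
open CatalanTwoAdicZeta (bernTwo exists_norm_bernTwo_le teichTwo teichTwo_one teichTwo_three hurwitzTwoAtTwo zetaTwoAtTwo
  xi_eq_zetaTwoAtTwo)

/-! ### The values `β(1−n)` and Washington's finite form -/

/-- `β(1−n) := −B_{n,χ₋₄}/n = −4^{n−1}·(B_n(¼) − B_n(¾))/n` (`n ≥ 1`; [Wa97, Prop. 4.1 + Thm. 4.2]; `B_n(x)` = `Polynomial.bernoulli`).
For odd `n` this is the Dirichlet-beta value `L(1−n, χ₋₄) = E_{n−1}/2`; it is the number `ζ₂(1−n)` interpolated by Kubota–Leopoldt. -/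
def betaOneSub (n : ℕ) : ℚ :=
  -(4 ^ (n - 1) * ((Polynomial.bernoulli n).eval (1 / 4 : ℚ) - (Polynomial.bernoulli n).eval (3 / 4 : ℚ))) / n

/-- `B_n(x) = Σ_{i=0}^{n} B_i·binom(n,i)·x^{n−i}` (Mathlib's definition of `Polynomial.bernoulli`, evaluated). -/
theorem bernoulliPoly_eval (n : ℕ) (x : ℚ) :
    (Polynomial.bernoulli n).eval x = ∑ i ∈ range (n + 1), _root_.bernoulli i * (n.choose i : ℚ) * x ^ (n - i) := by
  simp only [Polynomial.bernoulli, Polynomial.eval_finsetSum, Polynomial.eval_monomial]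

/-- `4^n·B_n(a/4) = Σ_{i=0}^{n} B_i·binom(n,i)·4^i·a^{n−i}`. -/
theorem four_pow_mul_bernoulliPoly_eval (n : ℕ) (a : ℚ) :
    4 ^ n * (Polynomial.bernoulli n).eval (a / 4) =
      ∑ i ∈ range (n + 1), _root_.bernoulli i * (n.choose i : ℚ) * 4 ^ i * a ^ (n - i) := by
  rw [bernoulliPoly_eval, mul_sum]
  refine sum_congr rfl fun i hi => ?_
  have hi' : i ≤ n := Nat.lt_succ_iff.mp (mem_range.mp hi)
  have h4 : (4 : ℚ) ^ n = 4 ^ i * 4 ^ (n - i) := by rw [← pow_add, Nat.add_sub_cancel' hi']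
  have h4' : (4 : ℚ) ^ (n - i) ≠ 0 := pow_ne_zero _ (by norm_num)
  rw [div_pow, h4]
  field_simp

/-- **Washington's series at `s = 1 − n` (terminating):** for `n ≥ 1`,
`β(1−n) = −(4n)⁻¹·(Σ_{i≤n} B_i binom(n,i) 4^i − 3^n·Σ_{i≤n} B_i binom(n,i) (4/3)^i)`
(= `(1/F)(1/(s−1)) Σ_{a=1,3} ⟨a⟩^{1−s} Σ_j binom(1−s,j)B_j(F/a)^j` at `s = 1−n`, `F = 4`, `⟨1⟩ = 1`, `⟨3⟩^{n} = (−3)^n = −3^n`, `n` odd —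
the identity itself holds for every `n ≥ 1`). -/
theorem betaOneSub_eq (n : ℕ) (hn : n ≠ 0) :
    betaOneSub n = -(4 * (n : ℚ))⁻¹ *
      ((∑ i ∈ range (n + 1), _root_.bernoulli i * (n.choose i : ℚ) * 4 ^ i) -
        3 ^ n * ∑ i ∈ range (n + 1), _root_.bernoulli i * (n.choose i : ℚ) * (4 / 3) ^ i) := by
  have h1 := four_pow_mul_bernoulliPoly_eval n 1
  have h3 := four_pow_mul_bernoulliPoly_eval n 3
  simp only [one_pow, mul_one] at h1
  have h3' : ∑ i ∈ range (n + 1), _root_.bernoulli i * (n.choose i : ℚ) * 4 ^ i * 3 ^ (n - i) =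
      3 ^ n * ∑ i ∈ range (n + 1), _root_.bernoulli i * (n.choose i : ℚ) * (4 / 3) ^ i := by
    rw [mul_sum]
    refine sum_congr rfl fun i hi => ?_
    have hi' : i ≤ n := Nat.lt_succ_iff.mp (mem_range.mp hi)
    have e3 : (3 : ℚ) ^ n = 3 ^ i * 3 ^ (n - i) := by rw [← pow_add, Nat.add_sub_cancel' hi']
    have h3i : (3 : ℚ) ^ i ≠ 0 := pow_ne_zero _ (by norm_num)
    rw [div_pow, e3]
    field_simp
  rw [h3'] at h3
  have hn4 : (4 : ℚ) ^ n ≠ 0 := pow_ne_zero _ (by norm_num)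
  have e1 : (Polynomial.bernoulli n).eval (1 / 4 : ℚ) = (∑ i ∈ range (n + 1), _root_.bernoulli i * (n.choose i : ℚ) * 4 ^ i) / 4 ^ n :=
    eq_div_of_mul_eq hn4 (by rw [mul_comm]; exact h1)
  have e3' : (Polynomial.bernoulli n).eval (3 / 4 : ℚ) =
      (3 ^ n * ∑ i ∈ range (n + 1), _root_.bernoulli i * (n.choose i : ℚ) * (4 / 3) ^ i) / 4 ^ n :=
    eq_div_of_mul_eq hn4 (by rw [mul_comm]; exact h3)
  obtain ⟨m, rfl⟩ := Nat.exists_eq_succ_of_ne_zero hn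
  rw [betaOneSub, e1, e3', Nat.succ_sub_one, pow_succ]
  have hm : ((m.succ : ℕ) : ℚ) ≠ 0 := Nat.cast_ne_zero.mpr hn
  have hm4 : (4 : ℚ) ^ m ≠ 0 := pow_ne_zero _ (by norm_num)
  field_simp

/-! ### 2-adic limits along `n = 2^N − 1 → −1` -/

/-- The index `n_N = 2^N − 1` (odd, `→ −1` in `ℤ₂`; `s = 1 − n_N = 2 − 2^N → 2`). -/
def idx (N : ℕ) : ℕ := 2 ^ N - 1

/-- `n_N = 2^N − 1` in `ℚ₂`. -/
theorem cast_idx (N : ℕ) : ((idx N : ℕ) : ℚ_[2]) = 2 ^ N - 1 := by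
  rw [idx, Nat.cast_sub Nat.one_le_two_pow, Nat.cast_pow, Nat.cast_ofNat, Nat.cast_one]

/-- `N ≤ n_N`. -/
theorem le_idx (N : ℕ) : N ≤ idx N := by
  have h : N < 2 ^ N := Nat.lt_two_pow_self
  rw [idx]; omega

/-- `2^N → 0` in `ℚ₂`. -/
theorem tendsto_two_pow : Tendsto (fun N : ℕ => (2 : ℚ_[2]) ^ N) atTop (𝓝 0) :=
  tendsto_pow_atTop_nhds_zero_of_norm_lt_one (by rw [norm_two_padic]; norm_num)

/-- `n_N → −1` in `ℚ₂`. -/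
theorem tendsto_idx : Tendsto (fun N : ℕ => ((idx N : ℕ) : ℚ_[2])) atTop (𝓝 (-1)) := by
  have h := (tendsto_two_pow.sub_const (1 : ℚ_[2])).congr fun N => (cast_idx N).symm
  simpa using h

/-- **`binom(n_N, j) → binom(−1, j) = (−1)^j`** in `ℚ₂`, for every fixed `j` (polynomiality of `binom(·, j)`). -/
theorem tendsto_choose (j : ℕ) :
    Tendsto (fun N : ℕ => (((idx N).choose j : ℕ) : ℚ_[2])) atTop (𝓝 ((-1) ^ j)) := by
  induction j with
  | zero => simp
  | succ j ih =>
    have key : ∀ᶠ N in atTop, (((idx N).choose j : ℕ) : ℚ_[2]) * (((idx N : ℕ) : ℚ_[2]) - j) / (j + 1) =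
        (((idx N).choose (j + 1) : ℕ) : ℚ_[2]) := by
      filter_upwards [eventually_ge_atTop j] with N hN
      have hjn : j ≤ idx N := le_trans hN (le_idx N)
      have h := congrArg (Nat.cast : ℕ → ℚ_[2]) (Nat.choose_succ_right_eq (idx N) j)
      push_cast [Nat.cast_sub hjn] at h
      have hj1 : ((j : ℚ_[2]) + 1) ≠ 0 := Nat.cast_add_one_ne_zero j
      rw [div_eq_iff hj1, h]
    have lim : Tendsto (fun N : ℕ => (((idx N).choose j : ℕ) : ℚ_[2]) * (((idx N : ℕ) : ℚ_[2]) - j) / (j + 1)) atTop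
        (𝓝 ((-1) ^ j * ((-1 : ℚ_[2]) - j) / (j + 1))) :=
      (ih.mul (tendsto_idx.sub_const _)).div_const _
    have hv : (-1 : ℚ_[2]) ^ j * ((-1 : ℚ_[2]) - j) / (j + 1) = (-1) ^ (j + 1) := by
      have hj1 : ((j : ℚ_[2]) + 1) ≠ 0 := Nat.cast_add_one_ne_zero j
      rw [div_eq_iff hj1, pow_succ]
      ring
    rw [← hv]
    exact lim.congr' key

/-- `‖3‖₂ = 1`. -/
theorem norm_three : ‖(3 : ℚ_[2])‖ = 1 := by
  have hne : ‖(1 : ℚ_[2])‖ ≠ ‖(2 : ℚ_[2])‖ := by rw [norm_one, norm_two_padic]; norm_num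
  rw [show (3 : ℚ_[2]) = 1 + 2 by norm_num, IsUltrametricDist.norm_add_eq_max_of_norm_ne_norm hne, norm_one, norm_two_padic]
  norm_num

/-- `‖4‖₂ = ¼`. -/
theorem norm_four : ‖(4 : ℚ_[2])‖ = (1 : ℝ) / 2 * (1 / 2) := by
  rw [show (4 : ℚ_[2]) = 2 * 2 by norm_num, norm_mul, norm_two_padic]

/-- **`‖3^{2^N} − 1‖₂ ≤ 2^{−(N+1)}`** (`3^{2^{N+1}} − 1 = (3^{2^N} − 1)(3^{2^N} + 1)` and the second factor is even). -/
theorem norm_three_pow_two_pow_sub_one (N : ℕ) : ‖(3 : ℚ_[2]) ^ (2 ^ N) - 1‖ ≤ ((1 : ℝ) / 2) ^ (N + 1) := by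
  induction N with
  | zero => simp [show (3 : ℚ_[2]) - 1 = 2 by norm_num, norm_two_padic]
  | succ N ih =>
    have e : (3 : ℚ_[2]) ^ (2 ^ (N + 1)) - 1 = ((3 : ℚ_[2]) ^ (2 ^ N) - 1) * ((3 : ℚ_[2]) ^ (2 ^ N) + 1) := by
      rw [pow_succ, pow_mul]; ring
    have hhalf : ((1 : ℝ) / 2) ^ (N + 1) ≤ 1 / 2 := by
      calc ((1 : ℝ) / 2) ^ (N + 1) ≤ ((1 : ℝ) / 2) ^ 1 := pow_le_pow_of_le_one (by norm_num) (by norm_num) (by omega)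
        _ = 1 / 2 := pow_one _
    have hx1 : ‖(3 : ℚ_[2]) ^ (2 ^ N) + 1‖ ≤ 1 / 2 := by
      rw [show (3 : ℚ_[2]) ^ (2 ^ N) + 1 = ((3 : ℚ_[2]) ^ (2 ^ N) - 1) + 2 by ring]
      refine (IsUltrametricDist.norm_add_le_max _ _).trans (max_le (ih.trans hhalf) ?_)
      rw [norm_two_padic]
    calc ‖(3 : ℚ_[2]) ^ (2 ^ (N + 1)) - 1‖ = ‖(3 : ℚ_[2]) ^ (2 ^ N) - 1‖ * ‖(3 : ℚ_[2]) ^ (2 ^ N) + 1‖ := by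
          rw [e, norm_mul]
      _ ≤ ((1 : ℝ) / 2) ^ (N + 1) * (1 / 2) := mul_le_mul ih hx1 (norm_nonneg _) (by positivity)
      _ = ((1 : ℝ) / 2) ^ (N + 1 + 1) := by ring

/-- `3^{2^N} → 1` in `ℚ₂`. -/
theorem tendsto_three_pow_two_pow : Tendsto (fun N : ℕ => (3 : ℚ_[2]) ^ (2 ^ N)) atTop (𝓝 1) := by
  have h0 : Tendsto (fun N : ℕ => ((1 : ℝ) / 2) ^ (N + 1)) atTop (𝓝 0) := by
    have h := (tendsto_pow_atTop_nhds_zero_of_lt_one (by norm_num : (0 : ℝ) ≤ 1 / 2) (by norm_num)).mul_const ((1 : ℝ) / 2)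
    rw [zero_mul] at h
    simpa [pow_succ] using h
  rw [tendsto_iff_norm_sub_tendsto_zero]
  exact squeeze_zero (fun N => norm_nonneg _) norm_three_pow_two_pow_sub_one h0

/-- **`3^{n_N} = 3^{2^N}/3 → 3⁻¹`** in `ℚ₂` (`⟨3⟩^{1−s} → ⟨3⟩^{−1}` along `s = 2 − 2^N`). -/
theorem tendsto_three_pow_idx : Tendsto (fun N : ℕ => (3 : ℚ_[2]) ^ idx N) atTop (𝓝 3⁻¹) := by
  have h := tendsto_three_pow_two_pow.const_mul (3⁻¹ : ℚ_[2])
  rw [mul_one] at h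
  refine h.congr fun N => ?_
  have e : (3 : ℚ_[2]) ^ (2 ^ N) = 3 ^ idx N * 3 := by
    rw [← pow_succ, idx, Nat.sub_add_cancel Nat.one_le_two_pow]
  rw [e]
  field_simp

/-! ### Tannery: the terminating sums converge to Washington's series at `s = 2` -/

/-- The `a = 1` terms at `s = 1 − n_N`: `binom(n_N, j)·B_j·4^j`. -/
def fOne (N j : ℕ) : ℚ_[2] := (((idx N).choose j : ℕ) : ℚ_[2]) * bernTwo j * 4 ^ j

/-- The `a = 3` terms at `s = 1 − n_N`: `binom(n_N, j)·B_j·(4/3)^j`. -/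
def fThree (N j : ℕ) : ℚ_[2] := (((idx N).choose j : ℕ) : ℚ_[2]) * bernTwo j * (4 / 3) ^ j

/-- The `a = 1` terms at `s = 2`: `(−1)^j·B_j·4^j`. -/
def gOne (j : ℕ) : ℚ_[2] := (-1) ^ j * bernTwo j * 4 ^ j

/-- The `a = 3` terms at `s = 2`: `(−1)^j·B_j·(4/3)^j`. -/
def gThree (j : ℕ) : ℚ_[2] := (-1) ^ j * bernTwo j * (4 / 3) ^ j

/-- Domination `‖binom(n_N,j)B_j4^j‖₂ ≤ C·2^{−j}`, uniformly in `N`. -/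
theorem norm_fOne_le {C : ℝ} (hC : ∀ n, ‖bernTwo n‖ ≤ C * 2 ^ n) (N j : ℕ) : ‖fOne N j‖ ≤ C * ((1 : ℝ) / 2) ^ j := by
  have hc : ‖(((idx N).choose j : ℕ) : ℚ_[2])‖ ≤ 1 := IsUltrametricDist.norm_natCast_le_one ℚ_[2] _
  have hC0 : 0 ≤ C := by have := (norm_nonneg _).trans (hC 0); simpa using this
  rw [fOne, norm_mul, norm_mul, norm_pow, norm_four]
  calc ‖(((idx N).choose j : ℕ) : ℚ_[2])‖ * ‖bernTwo j‖ * ((1 : ℝ) / 2 * (1 / 2)) ^ j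
      ≤ 1 * (C * 2 ^ j) * ((1 : ℝ) / 2 * (1 / 2)) ^ j :=
        mul_le_mul_of_nonneg_right (mul_le_mul hc (hC j) (norm_nonneg _) zero_le_one) (by positivity)
    _ = C * ((1 : ℝ) / 2) ^ j := by rw [one_mul, mul_assoc, ← mul_pow]; norm_num

/-- Domination `‖binom(n_N,j)B_j(4/3)^j‖₂ ≤ C·2^{−j}`, uniformly in `N` (`‖3‖₂ = 1`). -/
theorem norm_fThree_le {C : ℝ} (hC : ∀ n, ‖bernTwo n‖ ≤ C * 2 ^ n) (N j : ℕ) : ‖fThree N j‖ ≤ C * ((1 : ℝ) / 2) ^ j := by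
  have hc : ‖(((idx N).choose j : ℕ) : ℚ_[2])‖ ≤ 1 := IsUltrametricDist.norm_natCast_le_one ℚ_[2] _
  have hC0 : 0 ≤ C := by have := (norm_nonneg _).trans (hC 0); simpa using this
  rw [fThree, norm_mul, norm_mul, norm_pow, norm_div, norm_four, norm_three, div_one]
  calc ‖(((idx N).choose j : ℕ) : ℚ_[2])‖ * ‖bernTwo j‖ * ((1 : ℝ) / 2 * (1 / 2)) ^ j
      ≤ 1 * (C * 2 ^ j) * ((1 : ℝ) / 2 * (1 / 2)) ^ j :=
        mul_le_mul_of_nonneg_right (mul_le_mul hc (hC j) (norm_nonneg _) zero_le_one) (by positivity)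
    _ = C * ((1 : ℝ) / 2) ^ j := by rw [one_mul, mul_assoc, ← mul_pow]; norm_num

/-- **Tannery, `a = 1`:** `Σ'_j binom(n_N,j)B_j4^j → Σ'_j (−1)^jB_j4^j` in `ℚ₂`. -/
theorem tendsto_tsum_fOne : Tendsto (fun N : ℕ => ∑' j, fOne N j) atTop (𝓝 (∑' j, gOne j)) := by
  obtain ⟨C, _, hC⟩ := exists_norm_bernTwo_le
  refine tendsto_tsum_of_dominated_convergence (f := fOne) (g := gOne) (summable_geometric_two.mul_left C)
    (fun j => ?_) (Eventually.of_forall fun N j => norm_fOne_le hC N j)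
  simpa only [fOne, gOne] using ((tendsto_choose j).mul_const (bernTwo j)).mul_const ((4 : ℚ_[2]) ^ j)

/-- **Tannery, `a = 3`:** `Σ'_j binom(n_N,j)B_j(4/3)^j → Σ'_j (−1)^jB_j(4/3)^j` in `ℚ₂`. -/
theorem tendsto_tsum_fThree : Tendsto (fun N : ℕ => ∑' j, fThree N j) atTop (𝓝 (∑' j, gThree j)) := by
  obtain ⟨C, _, hC⟩ := exists_norm_bernTwo_le
  refine tendsto_tsum_of_dominated_convergence (f := fThree) (g := gThree) (summable_geometric_two.mul_left C)
    (fun j => ?_) (Eventually.of_forall fun N j => norm_fThree_le hC N j)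
  simpa only [fThree, gThree] using ((tendsto_choose j).mul_const (bernTwo j)).mul_const ((4 / 3 : ℚ_[2]) ^ j)

/-- The `s = 1 − n_N` sums terminate: `Σ'_j = Σ_{j ≤ n_N}` (`binom(n, j) = 0` for `j > n`). -/
theorem tsum_fOne (N : ℕ) : ∑' j, fOne N j = ∑ j ∈ range (idx N + 1), fOne N j :=
  tsum_eq_sum (s := range (idx N + 1)) fun j hj => by
    have hlt : idx N < j := by simpa [mem_range] using hj
    simp [fOne, Nat.choose_eq_zero_of_lt hlt]

/-- The `s = 1 − n_N` sums terminate (`a = 3`). -/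
theorem tsum_fThree (N : ℕ) : ∑' j, fThree N j = ∑ j ∈ range (idx N + 1), fThree N j :=
  tsum_eq_sum (s := range (idx N + 1)) fun j hj => by
    have hlt : idx N < j := by simpa [mem_range] using hj
    simp [fThree, Nat.choose_eq_zero_of_lt hlt]

/-- `β(1−n_N)` in `ℚ₂`, in Washington's form (`N ≥ 1`). -/
theorem cast_betaOneSub (N : ℕ) (hN : 1 ≤ N) :
    ((betaOneSub (idx N) : ℚ) : ℚ_[2]) =
      -(4 * ((idx N : ℕ) : ℚ_[2]))⁻¹ * ((∑' j, fOne N j) - 3 ^ idx N * ∑' j, fThree N j) := by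
  have hn : idx N ≠ 0 := by have := le_idx N; omega
  have hS1 : (((∑ i ∈ range (idx N + 1), _root_.bernoulli i * ((idx N).choose i : ℚ) * 4 ^ i : ℚ)) : ℚ_[2]) =
      ∑ j ∈ range (idx N + 1), fOne N j := by
    push_cast
    exact sum_congr rfl fun i _ => by simp only [fOne, bernTwo]; ring
  have hS3 : (((∑ i ∈ range (idx N + 1), _root_.bernoulli i * ((idx N).choose i : ℚ) * (4 / 3) ^ i : ℚ)) : ℚ_[2]) =
      ∑ j ∈ range (idx N + 1), fThree N j := by
    push_cast
    exact sum_congr rfl fun i _ => by simp only [fThree, bernTwo]; ring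
  rw [betaOneSub_eq _ hn, tsum_fOne, tsum_fThree, ← hS1, ← hS3]
  push_cast
  ring

/-- `ζ₂(2)` (K5d's `zetaTwoAtTwo = H₂(2;1,4) + H₂(2;3,4)`) in terms of the two limit series. -/
theorem zetaTwoAtTwo_eq_tsum : zetaTwoAtTwo = 4⁻¹ * ((∑' j, gOne j) - 3⁻¹ * ∑' j, gThree j) := by
  have e1 : (fun j : ℕ => (-1 : ℚ_[2]) ^ j * bernTwo j * (((4 : ℕ) : ℚ_[2]) / ((1 : ℕ) : ℚ_[2])) ^ j) = gOne := by
    funext j; simp [gOne]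
  have e3 : (fun j : ℕ => (-1 : ℚ_[2]) ^ j * bernTwo j * (((4 : ℕ) : ℚ_[2]) / ((3 : ℕ) : ℚ_[2])) ^ j) = gThree := by
    funext j; simp [gThree]
  rw [zetaTwoAtTwo, hurwitzTwoAtTwo, hurwitzTwoAtTwo, e1, e3, teichTwo_one, teichTwo_three]
  push_cast
  ring

/-- **Kernel K5e (relative to K5d's explicit `ζ₂(2)`):** `β(1 − n_N) → zetaTwoAtTwo` in `ℚ₂` — the interpolation property of
Washington's series at the point `s = 2`. -/
theorem tendsto_betaOneSub_zetaTwoAtTwo :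
    Tendsto (fun N : ℕ => ((betaOneSub (idx N) : ℚ) : ℚ_[2])) atTop (𝓝 zetaTwoAtTwo) := by
  have lim : Tendsto (fun N : ℕ => -(4 * ((idx N : ℕ) : ℚ_[2]))⁻¹ * ((∑' j, fOne N j) - 3 ^ idx N * ∑' j, fThree N j))
      atTop (𝓝 (-(4 * (-1 : ℚ_[2]))⁻¹ * ((∑' j, gOne j) - 3⁻¹ * ∑' j, gThree j))) :=
    ((tendsto_idx.const_mul 4).inv₀ (by norm_num)).neg.mul
      (tendsto_tsum_fOne.sub (tendsto_three_pow_idx.mul tendsto_tsum_fThree))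
  rw [zetaTwoAtTwo_eq_tsum, show (4 : ℚ_[2])⁻¹ = -(4 * (-1 : ℚ_[2]))⁻¹ by norm_num]
  refine lim.congr' ?_
  filter_upwards [eventually_ge_atTop 1] with N hN
  exact (cast_betaOneSub N hN).symm

/-- **Kernel K5e — `ξ` IS THE 2-ADIC INTERPOLATION OF THE DIRICHLET-BETA VALUES:**
`β(1 − (2^N − 1)) = β(2 − 2^N) → ξ` in `ℚ₂` as `N → ∞`.  With `ζ₂(1−n) = β(1−n)` (`n` odd) and the continuity of the
Kubota–Leopoldt function on `ℤ₂` ([Wa97, Thm. 5.11]) this is `ξ = ζ₂(2)`, independently of any closed formula for `ζ₂`. -/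
theorem tendsto_betaOneSub_xi : Tendsto (fun N : ℕ => ((betaOneSub (2 ^ N - 1) : ℚ) : ℚ_[2])) atTop (𝓝 xi) := by
  rw [xi_eq_zetaTwoAtTwo]
  exact tendsto_betaOneSub_zetaTwoAtTwo

/-- The interpolation DETERMINES `ξ`: any 2-adic limit of `β(2 − 2^N)` equals `ξ`. -/
theorem eq_xi_of_tendsto {y : ℚ_[2]} (hy : Tendsto (fun N : ℕ => ((betaOneSub (2 ^ N - 1) : ℚ) : ℚ_[2])) atTop (𝓝 y)) :
    y = xi :=
  tendsto_nhds_unique hy tendsto_betaOneSub_xi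

/-- Sanity values: `β(0) = ½ = E₀/2`, `β(−2) = −½ = E₂/2`, `β(−4) = 5/2 = E₄/2` (Euler numbers; [Wa97, §4]). -/
theorem betaOneSub_values : betaOneSub 1 = 1 / 2 ∧ betaOneSub 3 = -1 / 2 ∧ betaOneSub 5 = 5 / 2 := by
  have b2 : _root_.bernoulli 2 = 1 / 6 := by rw [bernoulli_eq_bernoulli'_of_ne_one (by norm_num), bernoulli'_two]
  have b3 : _root_.bernoulli 3 = 0 := by rw [bernoulli_eq_bernoulli'_of_ne_one (by norm_num), bernoulli'_three]
  have b4 : _root_.bernoulli 4 = -1 / 30 := by rw [bernoulli_eq_bernoulli'_of_ne_one (by norm_num), bernoulli'_four]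
  have b5 : _root_.bernoulli 5 = 0 := by
    rw [bernoulli_eq_bernoulli'_of_ne_one (by norm_num)]
    exact bernoulli'_eq_zero_of_odd (by decide) (by norm_num)
  refine ⟨?_, ?_, ?_⟩ <;>
  · rw [betaOneSub_eq _ (by norm_num)]
    norm_num [sum_range_succ, Nat.choose, bernoulli_zero, bernoulli_one, b2, b3, b4, b5]

/-! ### `β(1−n)` is Mathlib's Dirichlet `L`-value `L(1−n, χ₋₄)` -/

/-- The odd Dirichlet character mod `4` as a function `ZMod 4 → ℂ`: `χ₋₄ = (0, 1, 0, −1)`. -/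
def chiFour (j : ZMod 4) : ℂ := if j = 1 then 1 else if j = 3 then -1 else 0

open HurwitzZeta in
/-- **`β(1−n)` is a genuine `L`-value (kernel form of [Wa97, Prop. 4.1 + Thm. 4.2] for `χ₋₄`):** for `n ≥ 2`, Mathlib's
analytically continued congruence `L`-function `ZMod.LFunction χ₋₄` (`= Σ_m χ₋₄(m)m^{−s} = β(s)` for `re s > 1`,
`ZMod.LFunction_eq_LSeries`) takes the value `betaOneSub n = −4^{n−1}(B_n(¼) − B_n(¾))/n` at `s = 1 − n`
(via Mathlib's `hurwitzZeta_neg_nat`).  So `tendsto_betaOneSub_xi` reads: `L(2 − 2^N, χ₋₄) → ξ` 2-adically. -/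
theorem LFunction_chiFour_one_sub (n : ℕ) (hn : 2 ≤ n) :
    ZMod.LFunction chiFour (1 - (n : ℂ)) = ((betaOneSub n : ℚ) : ℂ) := by
  obtain ⟨k, rfl⟩ : ∃ k, n = k + 1 := ⟨n - 1, by omega⟩
  have hk : k ≠ 0 := by omega
  have hs : (1 - ((k + 1 : ℕ) : ℂ)) = -(k : ℂ) := by push_cast; ring
  have hcast : ∀ q : ℚ, ((((Polynomial.bernoulli (k + 1)).eval q : ℚ)) : ℂ) =
      ((Polynomial.bernoulli (k + 1)).map (algebraMap ℚ ℂ)).eval (q : ℂ) := fun q => by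
    rw [Polynomial.eval_map, ← eq_ratCast (algebraMap ℚ ℂ) q, Polynomial.eval₂_hom, eq_ratCast]
  have c0 : chiFour 0 = 0 := by rw [chiFour, if_neg (by decide), if_neg (by decide)]
  have c1 : chiFour 1 = 1 := by rw [chiFour, if_pos rfl]
  have c2 : chiFour 2 = 0 := by rw [chiFour, if_neg (by decide), if_neg (by decide)]
  have c3 : chiFour 3 = -1 := by rw [chiFour, if_neg (by decide), if_pos rfl]
  have t1 : ZMod.toAddCircle (1 : ZMod 4) = (((1 : ℝ) / 4 : ℝ) : UnitAddCircle) := by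
    rw [ZMod.toAddCircle_apply, show (1 : ZMod 4).val = 1 from rfl]; push_cast; rfl
  have t3 : ZMod.toAddCircle (3 : ZMod 4) = (((3 : ℝ) / 4 : ℝ) : UnitAddCircle) := by
    rw [ZMod.toAddCircle_apply, show (3 : ZMod 4).val = 3 from rfl]; push_cast; rfl
  have h1 := HurwitzZeta.hurwitzZeta_neg_nat hk (show (1 : ℝ) / 4 ∈ Set.Icc (0 : ℝ) 1 by norm_num)
  have h3 := HurwitzZeta.hurwitzZeta_neg_nat hk (show (3 : ℝ) / 4 ∈ Set.Icc (0 : ℝ) 1 by norm_num)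
  have hsum : ∑ j : ZMod 4, chiFour j * hurwitzZeta (ZMod.toAddCircle j) (-(k : ℂ)) =
      chiFour 0 * hurwitzZeta (ZMod.toAddCircle (0 : ZMod 4)) (-(k : ℂ)) +
        chiFour 1 * hurwitzZeta (ZMod.toAddCircle (1 : ZMod 4)) (-(k : ℂ)) +
        chiFour 2 * hurwitzZeta (ZMod.toAddCircle (2 : ZMod 4)) (-(k : ℂ)) +
        chiFour 3 * hurwitzZeta (ZMod.toAddCircle (3 : ZMod 4)) (-(k : ℂ)) :=
    Fin.sum_univ_four (fun j : ZMod 4 => chiFour j * hurwitzZeta (ZMod.toAddCircle j) (-(k : ℂ)))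
  rw [ZMod.LFunction, hs, hsum, c0, c1, c2, c3, t1, t3, h1, h3, neg_neg, Nat.cast_ofNat, Complex.cpow_natCast, betaOneSub,
    Nat.add_sub_cancel]
  push_cast
  rw [hcast, hcast]
  have hk1 : ((k : ℂ) + 1) ≠ 0 := Nat.cast_add_one_ne_zero k
  push_cast
  field_simp
  ring

/-- **Summary (K5e in `L`-function language):** there is one sequence of rational numbers `r_N` (`= betaOneSub (2^N − 1)`)
which in `ℂ` ARE the values `L(2 − 2^N, χ₋₄)` of Mathlib's Dirichlet `L`-function of `χ₋₄` (`N ≥ 2`) and which in `ℚ₂`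
converge to the lane's constant `ξ = ⅛Σ'_μ t_μ/(μ+½)` (`= ½·Σ_n 4^n/((2n+1)² binom(2n,n))` summed 2-adically, `CatalanTwoAdicFinal`).
In `ℝ` the same `L`-function at the limit point `s = 2` is Catalan's constant `G = β(2)`. -/
theorem xi_is_twoAdic_limit_of_LValues :
    ∃ r : ℕ → ℚ, (∀ N : ℕ, 2 ≤ N → ((r N : ℚ) : ℂ) = ZMod.LFunction chiFour (2 - 2 ^ N)) ∧
      Tendsto (fun N => ((r N : ℚ) : ℚ_[2])) atTop (𝓝 xi) := by
  refine ⟨fun N => betaOneSub (2 ^ N - 1), fun N hN => ?_, tendsto_betaOneSub_xi⟩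
  have h4 : 4 ≤ 2 ^ N := by
    calc 4 = 2 ^ 2 := by norm_num
      _ ≤ 2 ^ N := Nat.pow_le_pow_right (by norm_num) hN
  have h2 : 2 ≤ 2 ^ N - 1 := by omega
  rw [← LFunction_chiFour_one_sub _ h2]
  congr 1
  rw [Nat.cast_sub Nat.one_le_two_pow]
  push_cast
  ring

end Summit.KontsevichZagierPeriods.Zeta5Search.CatalanTwoAdicInterpolation

end
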